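import Summits.BirchSwinnertonDyer.BirchSwinnertonDyer.Theorems.ManinLocalTwoThreeLevelTwenty
import Summits.BirchSwinnertonDyer.BirchSwinnertonDyer.Theorems.ManinLocalTwoThreeNeronSqueeze
import Literature.NumberTheory.EllipticCurves.Rank1Residual.X11RankOneCertificates.Minimality
import HarnessLib

/-!
# Level 20: (S2)₂₀ and the Néron squeeze with `W₀ = [−2, 0, −4, 0, 0] ≅ 20a1`

Cell bsd-f2-manin, route `ManinLocalTwoThree` (crux C2 `ManinOddAtFour`: `4 ∣ 20`); continuation of
`ManinLocalTwoThreeLevelTwenty` (§1–§3: `D.f = φ₂₀`, the `η`-quotients `x`, `y` of `X₀(20)`, the identities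
from the limits (T1)₂₀–(T3)₂₀).  §4: with `X = x + 1/3`, `(X′)² = (2πiφ₂₀)²(4X³ − g₂X − g₃)` for
`(g₂, g₃) = (−44/3, −296/27)`, so (S2)₂₀ `Λ(φ₂₀) ⊆ Λ(−44/3, −296/27)`
(`AnalyticBridge.periodLattice_le_of_deriv_sq`; non-degeneracy from `x q² → 1`).  §5: that lattice is the
Néron lattice of the explicit globally minimal curve `W₀ = [−2, 0, −4, 0, 0]` (`c₄ = −176`, `c₆ = −2368`,
`Δ = −6400`, Cremona `20a1`), so the NÉRON SQUEEZE `NeronSqueeze.abs_maninConstant_eq_one_of_periodLattice_le`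
gives `|D.maninConstant| = 1` for every globally minimal `W` and every lattice-optimal `X₀(20)`-datum, modulo
(T1)₂₀–(T3)₂₀ (`abs_maninConstant_eq_one_twenty_of_tendsto`) — no complex multiplication is used.  BSD is not
proved by this.
-/

set_option autoImplicit false
set_option linter.dupNamespace false

noncomputable section

open Complex Filter Topology Set Function Asymptotics
open UpperHalfPlane hiding I
open scoped Real Topology Manifold MatrixGroups ModularForm
open ModularForm CongruenceSubgroup
open Literature.NumberTheory.EllipticCurves Literature.NumberTheory.EllipticCurves.ModularForms
open Summit.BirchSwinnertonDyer.BirchSwinnertonDyer.Theorems.ManinLocalTwoThree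

namespace Summit.BirchSwinnertonDyer.BirchSwinnertonDyer.Theorems.ManinLocalTwoThree.NeronSqueezeTwenty

open CuspToolkit AnalyticBridge LevelTwenty

/-! ## §4 (S2)₂₀: `Λ(φ₂₀) ⊆ Λ(−44/3, −296/27)`, the Néron lattice of `W₀ = [−2, 0, −4, 0, 0]` -/

/-- `x · q² → 1` at `i∞` (`Σ δ r_δ = −48`). [folklore] -/
theorem tendsto_x20_mul_qParam_sq :
    Tendsto (fun τ : ℍ ↦ etaQuotient 20 (expFn [(2, -1), (4, 1), (10, 5), (20, -5)]) τ
      * Function.Periodic.qParam 1 (τ : ℂ) ^ (2 : ℤ)) atImInfty (𝓝 1) := by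
  have h := tendsto_etaQuotient_div_qParam_zpow 20 (expFn [(2, -1), (4, 1), (10, 5), (20, -5)]) (-2)
    (by decide)
  refine h.congr fun τ ↦ ?_
  rw [zpow_neg, div_inv_eq_mul]

/-- Non-degeneracy: `4x³ + 4x² + 16x + 16 ≠ 0` somewhere (else `‖x‖ ≤ 5` everywhere, contradicting
`x q² → 1`, `q → 0`). [folklore] -/
theorem exists_x20_nondegenerate :
    ∃ τ₀ : ℍ, 4 * (etaQuotient 20 (expFn [(2, -1), (4, 1), (10, 5), (20, -5)]) τ₀ + 1 / 3) ^ 3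
      - (-44 / 3 : ℂ) * (etaQuotient 20 (expFn [(2, -1), (4, 1), (10, 5), (20, -5)]) τ₀ + 1 / 3)
      - (-296 / 27 : ℂ) ≠ 0 := by
  by_contra hne
  push Not at hne
  set x : ℍ → ℂ := etaQuotient 20 (expFn [(2, -1), (4, 1), (10, 5), (20, -5)]) with hx
  have hb : ∀ τ : ℍ, ‖x τ‖ ≤ 5 := by
    intro τ
    have h : x τ ^ 3 = -(x τ ^ 2 + 4 * x τ + 4) := by linear_combination (1 / 4 : ℂ) * hne τ
    have hn : ‖x τ‖ ^ 3 ≤ ‖x τ‖ ^ 2 + 4 * ‖x τ‖ + 4 := by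
      rw [← norm_pow, h, norm_neg]
      refine (norm_add_le _ _).trans ?_
      refine (add_le_add (norm_add_le _ _) le_rfl).trans ?_
      rw [norm_pow, norm_mul]
      norm_num
    by_contra hlt
    push Not at hlt
    nlinarith [norm_nonneg (x τ), sq_nonneg (‖x τ‖ - 5), mul_pos (by linarith : (0:ℝ) < ‖x τ‖)
      (by linarith : (0:ℝ) < ‖x τ‖)]
  have h0 : Tendsto (fun τ : ℍ ↦ x τ * Function.Periodic.qParam 1 (τ : ℂ) ^ (2 : ℤ)) atImInfty (𝓝 0) := by
    have hq := tendsto_qParam_zpow_atImInfty (m := 2) (by norm_num)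
    have hbd : IsBoundedUnder (· ≤ ·) atImInfty ((‖·‖) ∘ x) :=
      ⟨5, Filter.eventually_map.mpr (Filter.Eventually.of_forall hb)⟩
    have := hq.zero_mul_isBoundedUnder_le hbd
    exact this.congr fun τ ↦ mul_comm _ _
  exact one_ne_zero (tendsto_nhds_unique tendsto_x20_mul_qParam_sq h0)

/-- **(S2)₂₀ from the identities (I1), (I2a)**: the period lattice of `φ₂₀` lies in the lattice with
invariants `g₂ = −44/3 = c₄(W₀)/12`, `g₃ = −296/27 = c₆(W₀)/216` (analytic bridge with `X = x + 1/3`,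
`(X′)² = (2πiφ₂₀)²(4X³ − g₂X − g₃)`: `(2y − 2x − 4)² = 4x³ + 4x² + 16x + 16` on the curve). [cite: CremonaAlgorithms1997, §2.10] -/
theorem periodLatticeLe20_of_identities
    (h1 : ∀ τ : ℍ, etaQuotient 20 (expFn [(1, -1), (4, 1), (5, 5), (20, -5)]) τ ^ 2
      - 2 * etaQuotient 20 (expFn [(2, -1), (4, 1), (10, 5), (20, -5)]) τ
        * etaQuotient 20 (expFn [(1, -1), (4, 1), (5, 5), (20, -5)]) τ
      - 4 * etaQuotient 20 (expFn [(1, -1), (4, 1), (5, 5), (20, -5)]) τ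
      = etaQuotient 20 (expFn [(2, -1), (4, 1), (10, 5), (20, -5)]) τ ^ 3)
    (h2 : ∀ τ : ℍ, deriv (etaQuotient 20 (expFn [(2, -1), (4, 1), (10, 5), (20, -5)]) ∘ ofComplex) τ
      = -(2 * π * I * cuspFormEtaProductTwenty τ)
          * (2 * etaQuotient 20 (expFn [(1, -1), (4, 1), (5, 5), (20, -5)]) τ
            - 2 * etaQuotient 20 (expFn [(2, -1), (4, 1), (10, 5), (20, -5)]) τ - 4)) :
    ∃ L₁ : PeriodPair, L₁.g₂ = -44 / 3 ∧ L₁.g₃ = -296 / 27 ∧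
      ∀ z ∈ periodLattice cuspFormEtaProductTwenty, z ∈ L₁.lattice := by
  obtain ⟨L₁, hg2, hg3⟩ := PeriodPair.uniformization_holds (-44 / 3) (-296 / 27) (by norm_num)
  refine ⟨L₁, hg2, hg3, periodLattice_le_of_deriv_sq cuspFormEtaProductTwenty
    cuspFormEtaProductTwenty_ne_zero L₁
    (fun τ ↦ etaQuotient 20 (expFn [(2, -1), (4, 1), (10, 5), (20, -5)]) τ + 1 / 3)
    ((mdifferentiable_etaQuotient 20 _).add mdifferentiable_const)
    (fun γ τ ↦ by simp only [x20_smul γ τ]) ?_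
    (by rw [hg2, hg3]; exact exists_x20_nondegenerate)⟩
  intro τ
  have hd : deriv ((fun σ : ℍ ↦ etaQuotient 20 (expFn [(2, -1), (4, 1), (10, 5), (20, -5)]) σ + 1 / 3)
      ∘ ofComplex) τ = deriv (etaQuotient 20 (expFn [(2, -1), (4, 1), (10, 5), (20, -5)]) ∘ ofComplex) τ := by
    rw [show ((fun σ : ℍ ↦ etaQuotient 20 (expFn [(2, -1), (4, 1), (10, 5), (20, -5)]) σ + 1 / 3) ∘ ofComplex)
      = fun z ↦ (etaQuotient 20 (expFn [(2, -1), (4, 1), (10, 5), (20, -5)]) ∘ ofComplex) z + 1 / 3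
      from rfl, deriv_add_const]
  rw [hd, h2 τ, hg2, hg3]
  linear_combination 4 * (2 * π * I * cuspFormEtaProductTwenty τ) ^ 2 * (h1 τ)

/-! ## §5 The Néron squeeze with `W₀ = [−2, 0, −4, 0, 0] ≅ 20a1` -/

/-- `Δ(W₀) = −6400` for `W₀ = [−2, 0, −4, 0, 0]`. [cite: CremonaAlgorithms1997, Table 1 (20a1)] -/
theorem Δ_W20 : (⟨-2, 0, -4, 0, 0⟩ : WeierstrassCurve ℚ).Δ = -6400 := by
  norm_num [WeierstrassCurve.Δ, WeierstrassCurve.b₂, WeierstrassCurve.b₄, WeierstrassCurve.b₆,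
    WeierstrassCurve.b₈]

/-- `W₀ = [−2, 0, −4, 0, 0]` is an elliptic curve. [cite: CremonaAlgorithms1997, Table 1 (20a1)] -/
theorem isElliptic_W20 : (⟨-2, 0, -4, 0, 0⟩ : WeierstrassCurve ℚ).IsElliptic := by
  rw [WeierstrassCurve.isElliptic_iff, Δ_W20]; norm_num

/-- `W₀ = [−2, 0, −4, 0, 0]` is a global minimal model (`Δ = −2⁸·5²`: no prime `q` with `q¹² ∣ Δ`).
[cite: SilvermanAEC2009, VII.1 Remark 1.1] -/
theorem isGloballyMinimal_W20 : (⟨-2, 0, -4, 0, 0⟩ : WeierstrassCurve ℚ).IsGloballyMinimal := by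
  have h := Rank1Residual.X11RankOneCertificates.isGloballyMinimal_of_int_criterion (-2) 0 (-4) 0 0 ?_
  · simpa using h
  rintro q hq ⟨h12, -⟩
  rw [show Rank1Residual.X11RankOneCertificates.discOf [-2, 0, -4, 0, 0] = -6400 by decide] at h12
  have h' : q ^ 12 ∣ 6400 := by
    have := Int.natAbs_dvd_natAbs.mpr h12
    simpa [Int.natAbs_pow] using this
  have hle : q ^ 12 ≤ 6400 := Nat.le_of_dvd (by norm_num) h'
  have hq2 := hq.two_le
  have hq3 : q < 3 := by
    by_contra hge
    push Not at hge
    have := Nat.pow_le_pow_left hge 12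
    norm_num at this
    omega
  interval_cases q
  norm_num at h'

/-- The lattice with invariants `(−44/3, −296/27)` is a Néron lattice of `W₀ = [−2, 0, −4, 0, 0]`
(`c₄ = −176`, `c₆ = −2368`). [cite: CremonaAlgorithms1997, Table 1 (20a1)] -/
theorem isNeronLatticeOf_W20 {L₁ : PeriodPair} (hg2 : L₁.g₂ = -44 / 3) (hg3 : L₁.g₃ = -296 / 27) :
    IsNeronLatticeOf ((⟨-2, 0, -4, 0, 0⟩ : WeierstrassCurve ℚ).baseChange ℂ) L₁ := by
  constructor
  · rw [hg2]
    norm_num [WeierstrassCurve.baseChange, WeierstrassCurve.map_c₄, WeierstrassCurve.c₄,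
      WeierstrassCurve.b₂, WeierstrassCurve.b₄]
  · rw [hg3]
    norm_num [WeierstrassCurve.baseChange, WeierstrassCurve.map_c₆, WeierstrassCurve.c₆,
      WeierstrassCurve.b₂, WeierstrassCurve.b₄, WeierstrassCurve.b₆]

/-- **`|c| = 1` on `X₀(20)` from the three limits (T1)₂₀–(T3)₂₀ — the Néron squeeze at the first non-CM
level**: for every globally minimal `W/ℚ` and every `X₀(20)`-datum with the lattice clause.  No
modularity, no CDT, no printed Manin fact. [folklore] -/
theorem abs_maninConstant_eq_one_twenty_of_tendsto
    (hT1 : Tendsto (fun τ : ℍ ↦ ((2 * π * I)⁻¹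
      * deriv (etaQuotient 20 (expFn [(2, -1), (4, 1), (10, 5), (20, -5)]) ∘ ofComplex) τ
      + cuspFormEtaProductTwenty τ * (2 * etaQuotient 20 (expFn [(1, -1), (4, 1), (5, 5), (20, -5)]) τ
        - 2 * etaQuotient 20 (expFn [(2, -1), (4, 1), (10, 5), (20, -5)]) τ - 4))
      / Function.Periodic.qParam 1 (τ : ℂ)) atImInfty (𝓝 0))
    (hT2 : Tendsto (fun τ : ℍ ↦ ((2 * π * I)⁻¹
      * deriv (etaQuotient 20 (expFn [(1, -1), (4, 1), (5, 5), (20, -5)]) ∘ ofComplex) τ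
      + cuspFormEtaProductTwenty τ * (3 * etaQuotient 20 (expFn [(2, -1), (4, 1), (10, 5), (20, -5)]) τ ^ 2
        + 2 * etaQuotient 20 (expFn [(1, -1), (4, 1), (5, 5), (20, -5)]) τ))
      / Function.Periodic.qParam 1 (τ : ℂ)) atImInfty (𝓝 0))
    (hT3 : Tendsto (fun τ : ℍ ↦ etaQuotient 20 (expFn [(1, -1), (4, 1), (5, 5), (20, -5)]) τ ^ 2
      - 2 * etaQuotient 20 (expFn [(2, -1), (4, 1), (10, 5), (20, -5)]) τ
        * etaQuotient 20 (expFn [(1, -1), (4, 1), (5, 5), (20, -5)]) τ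
      - 4 * etaQuotient 20 (expFn [(1, -1), (4, 1), (5, 5), (20, -5)]) τ
      - etaQuotient 20 (expFn [(2, -1), (4, 1), (10, 5), (20, -5)]) τ ^ 3) atImInfty (𝓝 0))
    (W : WeierstrassCurve ℚ) [W.IsElliptic] [W.IsGloballyMinimal] (D : ModularParametrizationData W 20)
    (hopt : ∀ z ∈ D.L.lattice, ∃ w ∈ periodLattice D.f, z = D.c * w) :
    |D.maninConstant| = 1 := by
  have hx := deriv_x20_of_tendsto hT1
  have hy := deriv_y20_of_tendsto hT2
  obtain ⟨L₁, hg2, hg3, hle⟩ := periodLatticeLe20_of_identities (cubic20_of_deriv hx hy hT3) hx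
  haveI := isElliptic_W20
  haveI := isGloballyMinimal_W20
  refine NeronSqueeze.abs_maninConstant_eq_one_of_periodLattice_le (⟨-2, 0, -4, 0, 0⟩ : WeierstrassCurve ℚ)
    L₁ (isNeronLatticeOf_W20 hg2 hg3) W D (fun z hz ↦ hle z ?_) hopt
  rwa [f_eq_etaProductTwenty D] at hz

end Summit.BirchSwinnertonDyer.BirchSwinnertonDyer.Theorems.ManinLocalTwoThree.NeronSqueezeTwenty

end
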